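import Mathlib
import Literature.NumberTheory.LFunctions.Zhang2022.TypedSection15C
import HarnessLib

/-!
# §15 p. 87 of Zhang (2022), front end of `Step15_u055RelS`: the Mellin integral of u054 IS the
# line integral of the contour theorem (exact identity on `Re s = 1`)

Topic `Literature/NumberTheory/LFunctions/Zhang2022` (Landau–Siegel audit tree; verdict-neutral).
Y. Zhang, *Discrete mean estimates and the Landau–Siegel zero*, arXiv:2211.02515v1 (2022)
[Zhang2022LandauSiegel] — **an unrefereed manuscript under adjudication**; nothing here asserts or denies
its Theorems 1–2. Step "`Σ_{n<T} χ(n)τ₂(n)ϖ₁ⱼ(n)/n = … = (2πi)⁻¹∫_{(1)} ζ(1+s)²L(1+s,χ)²𝒰₁ⱼ(1+s)Tˢω₁(s)ds/s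
+ O(α₁)`" (§15 p. 87, tex L4354–L4361), FRONT END in the reading of record
`Typed.Section15C.Step15_u055RelS` (RT-07′): the typed Mellin integral `Typed.Section15C.mellinIntegral`
(integrand `ζ(1+s)²L(1+s,χ)²·calU1(1+s)·Tˢω₁(s)/s`, with the PRINTED normaliser `(ζ²L(·,χ)²)⁻¹` inside
`calU1`) coincides, for every `U` with `IsCalU1R U` (the analytic continuation of the REPAIRED object
`calU1R`, normaliser `(ζ(s)²L(s−βⱼ,χ)²)⁻¹`), with the line integral
`(1/2π)∫_ℝ ζ(2+it)²L(2+it−βⱼ,χ)²U(2+it)·T^{1+it}ω₁(1+it)/(1+it) dt` — the left side of the contour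
theorem `U055.norm_integral_sub_residue_le` (`Section15CU055Contour`). Reason: on the line `Re(1+s) = 2`
both normalisers cancel against their prefactors (`ζ(2+it) ≠ 0`, `L(2+it,χ) ≠ 0`,
`L(2+it−βⱼ,χ) ≠ 0` since `Re βⱼ = 0`, Mathlib `riemannZeta_ne_zero_of_one_le_re` /
`DirichletCharacter.LFunction_ne_zero_of_one_le_re`), so BOTH integrands are the raw Dirichlet series
`Σₙ χ(n)τ₂(n)ϖ₁ⱼ(n)n^{−(2+it)}` times the §4 kernel. Pointwise identity
(`mellinIntegrand_eq_lineIntegrand`), then `integral_congr` (`mellinIntegral_eq_lineIntegral`).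
Generic in the coefficient package `X : Inputs15AB`; no hypothesis on `D` or `χ` is needed.
Theorems only. WHAT THIS IS NOT: the unsmoothing (`Section15CStep15u054`), the contour shift
(`Section15CU055Contour`) or the residue (`Section15CU055ResidueTerm`); nor anything about
Theorems 1–2 / Landau–Siegel zeros.

## References
* Y. Zhang, arXiv:2211.02515v1 (2022), §15 p. 87, tex L4354–L4361. [cite: Zhang2022LandauSiegel, §15 p.87]
-/

noncomputable section

open Complex Real

namespace Literature.NumberTheory.LFunctions.Zhang2022.U055

open Literature.NumberTheory.LFunctions.Zhang2022.Skeleton GaussWeight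
open Literature.NumberTheory.LFunctions.Zhang2022.Typed.Section15C

variable (c' : ℝ) (X : Inputs15AB) {D : ℕ} [NeZero D] (χ : DirichletCharacter ℂ D)

/-- **Pointwise identity on the line `Re s = 1`** (§15 p. 87, tex L4356): for `U` the analytic
continuation of the repaired `𝒰₁ⱼ` (`IsCalU1R`), the typed integrand
`ζ(1+s)²L(1+s,χ)²·calU1(1+s)·Tˢω₁(s)/s` at `s = 1+it` equals
`ζ(2+it)²L(2+it−βⱼ,χ)²U(2+it)·T^{1+it}ω₁(1+it)/(1+it)`: both are the raw series
`Σₙ χ(n)τ₂(n)ϖ₁ⱼ(n)n^{−(2+it)}` times the kernel, the normalisers cancelling on `Re = 2`.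
[cite: Zhang2022LandauSiegel, §15 p.87] -/
theorem mellinIntegrand_eq_lineIntegrand (j : ℕ) {U : ℂ → ℂ} (hU : IsCalU1R c' X χ j U) (t : ℝ) :
    mellinIntegrand c' X χ j (1 + t * I) =
      (riemannZeta (1 + (((1 : ℝ) : ℂ) + t * I)) ^ 2 *
          (χ.LFunction (1 + (((1 : ℝ) : ℂ) + t * I) - betaJ c' D j) ^ 2 *
            U (1 + (((1 : ℝ) : ℂ) + t * I)))) *
        (((bigT D : ℝ) : ℂ) ^ (((1 : ℝ) : ℂ) + t * I) * omega1 (ell D ^ 30) (((1 : ℝ) : ℂ) + t * I) /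
          (((1 : ℝ) : ℂ) + t * I)) := by
  have hre : (1 + ((((1 : ℝ) : ℂ)) + (t : ℂ) * I)).re = 2 := by simp; norm_num
  have h1 : 1 < (1 + ((((1 : ℝ) : ℂ)) + (t : ℂ) * I)).re := by rw [hre]; norm_num
  have hβ : (betaJ c' D j).re = 0 := Typed.AppendixB.betaJ_re c' D j
  have hreβ : (1 + ((((1 : ℝ) : ℂ)) + (t : ℂ) * I) - betaJ c' D j).re = 2 := by
    rw [Complex.sub_re, hre, hβ]; norm_num
  have hζ : riemannZeta (1 + ((((1 : ℝ) : ℂ)) + (t : ℂ) * I)) ≠ 0 :=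
    riemannZeta_ne_zero_of_one_le_re (by rw [hre]; norm_num)
  have hL : χ.LFunction (1 + ((((1 : ℝ) : ℂ)) + (t : ℂ) * I)) ≠ 0 :=
    DirichletCharacter.LFunction_ne_zero_of_one_le_re χ
      (Or.inr (by intro h; have := congrArg Complex.re h; rw [hre] at this; norm_num at this))
      (by rw [hre]; norm_num)
  have hLβ : χ.LFunction (1 + ((((1 : ℝ) : ℂ)) + (t : ℂ) * I) - betaJ c' D j) ≠ 0 :=
    DirichletCharacter.LFunction_ne_zero_of_one_le_re χ
      (Or.inr (by intro h; have := congrArg Complex.re h; rw [hreβ] at this; norm_num at this))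
      (by rw [hreβ]; norm_num)
  rw [hU.2 _ h1, mellinIntegrand, calU1, calU1R]
  push_cast
  have hζ' : riemannZeta (1 + (1 + (t : ℂ) * I)) ≠ 0 := by simpa using hζ
  have hL' : χ.LFunction (1 + (1 + (t : ℂ) * I)) ≠ 0 := by simpa using hL
  have hLβ' : χ.LFunction (1 + (1 + (t : ℂ) * I) - betaJ c' D j) ≠ 0 := by simpa using hLβ
  field_simp

/-- **The Mellin integral of u054 is the contour theorem's line integral** (§15 p. 87, tex L4356; FRONT
END of `Typed.Section15C.Step15_u055RelS`): for every coefficient package `X`, every `j` and every `U`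
with `IsCalU1R c′ X χ j U`,
`mellinIntegral c′ X χ j = (1/2π)∫_ℝ ζ(2+it)²L(2+it−βⱼ,χ)²U(2+it)·T^{1+it}ω₁(𝓛³⁰;1+it)/(1+it) dt`
— the right side is literally the integral of `U055.norm_integral_sub_residue_le` at `β = βⱼ`.
[cite: Zhang2022LandauSiegel, §15 p.87] -/
theorem mellinIntegral_eq_lineIntegral (j : ℕ) {U : ℂ → ℂ} (hU : IsCalU1R c' X χ j U) :
    mellinIntegral c' X χ j =
      (1 / (2 * π) : ℂ) * ∫ t : ℝ,
        (riemannZeta (1 + (((1 : ℝ) : ℂ) + t * I)) ^ 2 *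
            (χ.LFunction (1 + (((1 : ℝ) : ℂ) + t * I) - betaJ c' D j) ^ 2 *
              U (1 + (((1 : ℝ) : ℂ) + t * I)))) *
          (((bigT D : ℝ) : ℂ) ^ (((1 : ℝ) : ℂ) + t * I) * omega1 (ell D ^ 30) (((1 : ℝ) : ℂ) + t * I) /
            (((1 : ℝ) : ℂ) + t * I)) := by
  have hc : (((1 / (2 * π) : ℝ)) : ℂ) = (1 / (2 * π) : ℂ) := by push_cast; ring
  rw [mellinIntegral, hc]
  congr 1
  refine MeasureTheory.integral_congr_ae (Filter.Eventually.of_forall fun t => ?_)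
  exact mellinIntegrand_eq_lineIntegrand c' X χ j hU t

/-- The same at the manuscript's own objects `X = inputs15AB` (the instance the closer
`step15_u055RelS_holds` consumes). [cite: Zhang2022LandauSiegel, §15 p.87] -/
theorem mellinIntegral_inputs15AB_eq_lineIntegral (j : ℕ) {U : ℂ → ℂ}
    (hU : IsCalU1R c' inputs15AB χ j U) :
    mellinIntegral c' inputs15AB χ j =
      (1 / (2 * π) : ℂ) * ∫ t : ℝ,
        (riemannZeta (1 + (((1 : ℝ) : ℂ) + t * I)) ^ 2 *
            (χ.LFunction (1 + (((1 : ℝ) : ℂ) + t * I) - betaJ c' D j) ^ 2 *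
              U (1 + (((1 : ℝ) : ℂ) + t * I)))) *
          (((bigT D : ℝ) : ℂ) ^ (((1 : ℝ) : ℂ) + t * I) * omega1 (ell D ^ 30) (((1 : ℝ) : ℂ) + t * I) /
            (((1 : ℝ) : ℂ) + t * I)) :=
  mellinIntegral_eq_lineIntegral c' inputs15AB χ j hU

end Literature.NumberTheory.LFunctions.Zhang2022.U055
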